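import Summits.QuantumAdvantage.AdviceFreeQNC0.GapLawThree
import HarnessLib

/-!
# The GAP-3 LAW on `Fin n` and the GLOBAL-JUNTA corollary (planner qa-qnc0-p2 g15, ROUND-15 §3.14)

Statements VERBATIM from `HOME/qa-qnc0-p2/line15/SketchGap.lean`: `GapLaw m num den` (a strategy NONE of whose cuts reads the
bits of some length-`m` interval wins on `≤ (1 − num/den)·2ⁿ`), `GapLawThree := GapLaw 3 1 4`, `gapLaw_mono` (planner's proof),
and `GlobalJuntaThreeQuarters` (one read set `J` for all cuts with `4·|J| + 3 ≤ n` ⇒ `#WIN ≤ (3/4)·2ⁿ`).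
PROVED: **`gapLawThree`** (transport of `gapLawThreeG` from the `glue3` frame: `n = a + 3 + q`, inputs agreeing off the window
are `glue3`-fibres), hence `gapLaw_of_three_le` (any unread interval of length `≥ 3`), and **`globalJuntaThreeQuarters`**
(pigeonhole: the `|J| + 1` disjoint windows `[3j, 3j+3)`, `j ≤ |J|`, cannot all meet `J`; the free one fits since `3|J| + 3 ≤ 4|J| + 3 ≤ n`).  Degree-free, field-free; the
constant `3/4` is sharp for 3-windows (p2's run model).  WHAT THIS IS NOT: the conjectured all-`m` law `GapLawConj`
(`2/3 + (4/3)2^{−m}`) is not attempted; orthogonal to the dense crux; separation NOT moved.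
-/

namespace Summit.QuantumAdvantage.AdviceFreeQNC0

open Finset

/-! ## §1 Statements (verbatim) -/

/-- **THE GAP LAW** (shape): no cut reads the bits of `[a, a+m)` ⇒ `#win ≤ (1 − num/den)·2^n`, for EVERY strategy and every `c`. -/
def GapLaw (m num den : ℕ) : Prop :=
  ∀ (n c a : ℕ), a + m ≤ n → ∀ y : Fin (n + 1) → (Fin n → Bool) → Bool,
    (∀ g, ∀ u v : Fin n → Bool, (∀ i : Fin n, (i.val < a ∨ a + m ≤ i.val) → u i = v i) → y g u = y g v) →
      den * (Finset.univ.filter fun u : Fin n → Bool => ringWinU c y u = true).card ≤ (den - num) * 2 ^ n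

/-- **GAP-3 LAW** (sharp): ignoring three consecutive bits costs a quarter of the inputs. -/
def GapLawThree : Prop := GapLaw 3 1 4

/-- corollary shape: a GLOBAL junta `J` (one read set for all cuts) with `4·|J| + 3 ≤ n` wins on `≤ (3/4)·2^n` inputs
(pigeonhole: the complement of `J` contains an interval of length `≥ 3`). Field-free, degree-free; constant sharp. -/
def GlobalJuntaThreeQuarters : Prop :=
  ∀ (n c : ℕ) (J : Finset (Fin n)), 4 * J.card + 3 ≤ n → ∀ y : Fin (n + 1) → (Fin n → Bool) → Bool,
    (∀ g, ∀ u v : Fin n → Bool, (∀ i ∈ J, u i = v i) → y g u = y g v) →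
      4 * (Finset.univ.filter fun u : Fin n → Bool => ringWinU c y u = true).card ≤ 3 * 2 ^ n

/-- MONOTONICITY (planner's proof): a longer unread interval contains a shorter one. -/
theorem gapLaw_mono {m m' num den : ℕ} (hmm : m ≤ m') (h : GapLaw m num den) : GapLaw m' num den := by
  intro n c a ham y hy
  refine h n c a (le_trans (Nat.add_le_add_left hmm a) ham) y ?_
  intro g u v huv
  refine hy g u v ?_
  intro i hi
  exact huv i (hi.elim Or.inl fun h2 => Or.inr (le_trans (Nat.add_le_add_left hmm a) h2))

/-! ## §2 From the `glue3` frame to `Fin n` -/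

variable {p ℓ q : ℕ}

/-- two glued inputs with the same outside blocks agree outside the window (cf. `BlindWindowPolylog.glue3_eq_outside`). -/
private theorem glue3_eq_outside' (a : Fin p → Bool) (v v' : Fin ℓ → Bool) (b : Fin q → Bool)
    (i : Fin (p + ℓ + q)) (hi : i.val < p ∨ p + ℓ ≤ i.val) : glue3 a v b i = glue3 a v' b i := by
  unfold glue3
  induction i using Fin.addCases with
  | left k =>
    simp only [Fin.append_left]
    induction k using Fin.addCases with
    | left k₀ => simp only [Fin.append_left]
    | right k₁ =>
      exfalso
      have h1 := k₁.isLt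
      simp only [Fin.val_castAdd, Fin.val_natAdd] at hi
      omega
  | right k => simp only [Fin.append_right]

/-- **`GapLawThree` — PROVED** (transport of `gapLawThreeG`). -/
theorem gapLawThree : GapLawThree := by
  intro n c a han y hy
  obtain ⟨q, rfl⟩ : ∃ q, n = a + 3 + q := ⟨n - (a + 3), by omega⟩
  refine gapLawThreeG a q c y fun g a' v v' b => hy g _ _ fun i hi => ?_
  exact glue3_eq_outside' a' v v' b i hi

/-- any unread interval of length `≥ 3` costs a quarter. -/
theorem gapLaw_of_three_le {m : ℕ} (hm : 3 ≤ m) : GapLaw m 1 4 := gapLaw_mono hm gapLawThree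

/-! ## §3 Global juntas -/

/-- pigeonhole: a set `J ⊆ Fin n` misses one of the `|J| + 1` windows `[3j, 3j+3)`, `j ≤ |J|`. -/
theorem exists_window_disjoint {n : ℕ} (J : Finset (Fin n)) :
    ∃ j : ℕ, j ≤ J.card ∧ ∀ i ∈ J, i.val < 3 * j ∨ 3 * j + 3 ≤ i.val := by
  by_contra hcon
  push Not at hcon
  -- every window `j ≤ |J|` contains an element of `J`; choose one: an injection `Fin (|J|+1) ↪ J`
  have hpick : ∀ j : Fin (J.card + 1), ∃ i ∈ J, 3 * j.val ≤ i.val ∧ i.val < 3 * j.val + 3 := by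
    intro j
    obtain ⟨i, hi, h1, h2⟩ := hcon j.val (Nat.le_of_lt_succ j.isLt)
    exact ⟨i, hi, h1, h2⟩
  choose f hf using hpick
  have hinj : Function.Injective f := by
    intro j j' hjj
    have h1 := (hf j).2
    have h2 := (hf j').2
    rw [hjj] at h1
    apply Fin.ext
    omega
  have hcard := Finset.card_le_card_of_injOn (s := (univ : Finset (Fin (J.card + 1)))) (t := J) f
    (fun j _ => (hf j).1) (hinj.injOn)
  rw [card_univ, Fintype.card_fin] at hcard
  omega

/-- **`GlobalJuntaThreeQuarters` — PROVED**: a strategy all of whose cuts read only a set `J` of input bits with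
`4·|J| + 3 ≤ n` (tables arbitrary, no degree hypothesis) wins on at most `(3/4)·2ⁿ` inputs. -/
theorem globalJuntaThreeQuarters : GlobalJuntaThreeQuarters := by
  intro n c J hJ y hy
  obtain ⟨j, hj, hjJ⟩ := exists_window_disjoint J
  -- the window `[3j, 3j+3)` fits: `3j + 3 ≤ 3|J| + 3 ≤ 4|J| + 3 ≤ n`
  have h3 : 3 * j + 3 ≤ n := by omega
  have := gapLawThree n c (3 * j) h3 y fun g u v huv => hy g u v fun i hi => huv i (hjJ i hi)
  simpa using this

end Summit.QuantumAdvantage.AdviceFreeQNC0
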